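import Mathlib
import Summits.AtomisticToContinuum.HydrodynamicLimit.Theorems.ImplosionDichotomyDenseExcursionR2Modes

/-!
# Every weighted `C^k` seminorm of a centre-regular pair is finite on `x ≤ 1`
# (crux `DenseExcursion`, stmt-AtomisticToContinuum-12586, line `sonic-cavity-renewal` v6, helper for stub `stub_largeRealResolventCk`)

Helper file (`--supports stmt-AtomisticToContinuum-12586`) proving the registered helper
`iteratedDeriv_bound_of_isRegularPair`:

  `∀ k f g, IsRegularPair f g → ∃ N, ∀ y ≤ 1, ∀ j ≤ k, ‖iteratedDeriv j f y‖ + eʸ ‖iteratedDeriv j g y‖ ≤ N`,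

i.e. (with the body of `WCkBound` of `…SonicCavityDefsB` written out) every smooth centre-regular COMPLEX pair `(f, g)` has
finite weighted `C^k` seminorm on the core + margin `x ≤ 1`, for every `k`. This is the one new ingredient of the v6 stub
`stub_largeRealResolventCk` (the v5 proof `…PackingLargeRealResolvent` only needed the case `k = 0`,
`weightedSup_of_isRegularPair`).

**Mathematics.** `IsRegularPair f g` provides `C^∞` fields `F₁, F₂ : ℝ³ → ℝ³`, `G₁, G₂ : ℝ³ → ℝ` with
`(Re f(log ‖y‖)) y = F₁ y`, `(Im f(log ‖y‖)) y = F₂ y`, `‖y‖ Re g(log ‖y‖) = G₁ y`, `‖y‖ Im g(log ‖y‖) = G₂ y` off the origin.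
Along the ray `t ↦ t e₀` put `φ(t) := ½[(F₁(t e₀) − F₁(−t e₀))₀ + i (F₂(t e₀) − F₂(−t e₀))₀]` (the odd part of the first
coordinate, so `φ(0) = 0` for free) and `ψ(t) := G₁(t e₀) + i G₂(t e₀)`: smooth `ℝ → ℂ`, and for every real `x`

  `f(x) = e^{−x} φ(eˣ)`,  `g(x) = e^{−x} ψ(eˣ)`.

The conjugated form `x ↦ e^{−x} u(eˣ)` is stable under `d/dx`: `(e^{−x} u(eˣ))′ = e^{−x} (T u)(eˣ)` with the Euler-type
operator `T u (t) = t u′(t) − u(t)`, which preserves smoothness and the vanishing at `t = 0`. Hence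
`iteratedDeriv j f = e^{−x} v(eˣ)` with `v = Tʲφ` smooth, `v(0) = 0`, so `‖v(t)‖ ≤ K t` on `[0, e]` (mean value inequality,
`K = sup_{[0,e]} ‖v′‖`), i.e. `‖f⁽ʲ⁾(x)‖ ≤ K` for `x ≤ 1`; and `eˣ iteratedDeriv j g (x) = w(eˣ)` with `w = Tʲψ` continuous, hence
bounded on `[0, e]`. A `max` over `j ≤ k` finishes.

NOT here: `WCkBound`/`CavityResolventCk` (file `…SonicCavityDefsB`) and the stub itself (file `…PackingLargeRealResolventCk`).
-/

noncomputable section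

open Set Filter Topology
open scoped ContDiff

namespace Summit.AtomisticToContinuum.HydrodynamicLimit.Theorems.PackingAnalyticImplosion

open Literature.MathematicalPhysics.KineticTheory (V3)
open Summit.AtomisticToContinuum.HydrodynamicLimit.Theorems.KidderKnobMelnikov
  (norm_smul_unitVec smul_unitVec_apply_zero)
open Summit.AtomisticToContinuum.HydrodynamicLimit.Theorems.R2OneModeTwoConditions

/-! ## The conjugated form `x ↦ e^{-x} u(eˣ)` and the Euler-type operator `T u = t u′ − u` -/

/-- The conjugated form is stable under `d/dx`: `(e^{−x} u(eˣ))′ = e^{−x} (eˣ u′(eˣ) − u(eˣ)) = e^{−x} (T u)(eˣ)` for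
differentiable `u : ℝ → ℂ`. [folklore] -/
theorem hasDerivAt_expConj {u : ℝ → ℂ} (hu : Differentiable ℝ u) (x : ℝ) :
    HasDerivAt (fun x => ((Real.exp (-x) : ℝ) : ℂ) * u (Real.exp x))
      (((Real.exp (-x) : ℝ) : ℂ) * (((Real.exp x : ℝ) : ℂ) * deriv u (Real.exp x) - u (Real.exp x))) x := by
  have h1 : HasDerivAt (fun y : ℝ => ((Real.exp (-y) : ℝ) : ℂ)) (((Real.exp (-x) * -1 : ℝ)) : ℂ) x :=
    ((hasDerivAt_neg x).exp).ofReal_comp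
  have h2 : HasDerivAt (fun y : ℝ => u (Real.exp y)) (Real.exp x • deriv u (Real.exp x)) x :=
    (hu (Real.exp x)).hasDerivAt.scomp x (Real.hasDerivAt_exp x)
  refine (h1.mul h2).congr_deriv ?_
  rw [Complex.real_smul]
  push_cast
  ring

/-- The Euler-type operator `T u (t) = t u′(t) − u(t)` preserves smoothness. [folklore] -/
theorem contDiff_eulerOp {u : ℝ → ℂ} (hu : ContDiff ℝ ∞ u) :
    ContDiff ℝ ∞ (fun t : ℝ => ((t : ℝ) : ℂ) * deriv u t - u t) :=
  (Complex.ofRealCLM.contDiff.mul (contDiff_infty_iff_deriv.1 hu).2).sub hu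

/-- ITERATED DERIVATIVES OF THE CONJUGATED FORM: for smooth `u` and every `j`,
`iteratedDeriv j (x ↦ e^{−x} u(eˣ)) = x ↦ e^{−x} v(eˣ)` for some smooth `v` (namely `v = Tʲ u`), and `v(0) = 0` whenever
`u(0) = 0` (since `(T u)(0) = −u(0)`). [folklore] -/
theorem iteratedDeriv_expConj (j : ℕ) :
    ∀ {u : ℝ → ℂ}, ContDiff ℝ ∞ u →
      ∃ v : ℝ → ℂ, ContDiff ℝ ∞ v ∧ (u 0 = 0 → v 0 = 0) ∧
        iteratedDeriv j (fun x => ((Real.exp (-x) : ℝ) : ℂ) * u (Real.exp x)) =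
          fun x => ((Real.exp (-x) : ℝ) : ℂ) * v (Real.exp x) := by
  induction j with
  | zero =>
    intro u hu
    exact ⟨u, hu, id, iteratedDeriv_zero⟩
  | succ j ih =>
    intro u hu
    obtain ⟨v, hv, hv0, hvj⟩ := ih (contDiff_eulerOp hu)
    refine ⟨v, hv, fun hu0 => hv0 (by simp [hu0]), ?_⟩
    rw [iteratedDeriv_succ']
    have hd : deriv (fun x => ((Real.exp (-x) : ℝ) : ℂ) * u (Real.exp x)) =
        fun x => ((Real.exp (-x) : ℝ) : ℂ) * (((Real.exp x : ℝ) : ℂ) * deriv u (Real.exp x) - u (Real.exp x)) :=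
      funext fun x => (hasDerivAt_expConj (hu.differentiable (by simp)) x).deriv
    rw [hd]
    exact hvj

/-- UNWEIGHTED BOUND: if `v` is smooth with `v(0) = 0`, then `‖e^{−x} v(eˣ)‖ ≤ K` for `x ≤ 1`, with `K = sup_{[0,e]} ‖v′‖`
(mean value inequality on `[0, e]`: `‖v(t)‖ = ‖v(t) − v(0)‖ ≤ K t`). [folklore] -/
theorem norm_expConj_le_of_apply_zero {v : ℝ → ℂ} (hv : ContDiff ℝ ∞ v) (hv0 : v 0 = 0) :
    ∃ K : ℝ, ∀ x : ℝ, x ≤ 1 → ‖((Real.exp (-x) : ℝ) : ℂ) * v (Real.exp x)‖ ≤ K := by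
  obtain ⟨K, hK⟩ := (isCompact_Icc : IsCompact (Icc (0 : ℝ) (Real.exp 1))).exists_bound_of_continuousOn
    ((hv.continuous_deriv (by simp)).continuousOn)
  refine ⟨K, fun x hx => ?_⟩
  have hpos : 0 < Real.exp x := Real.exp_pos x
  have hmem : Real.exp x ∈ Icc (0 : ℝ) (Real.exp 1) := ⟨hpos.le, Real.exp_le_exp.2 hx⟩
  have h0 : (0 : ℝ) ∈ Icc (0 : ℝ) (Real.exp 1) := ⟨le_rfl, (Real.exp_pos 1).le⟩
  have hmvt : ‖v (Real.exp x) - v 0‖ ≤ K * ‖Real.exp x - 0‖ :=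
    (convex_Icc (0 : ℝ) (Real.exp 1)).norm_image_sub_le_of_norm_deriv_le
      (fun t _ => (hv.differentiable (by simp)) t) hK h0 hmem
  rw [hv0, sub_zero, sub_zero, Real.norm_of_nonneg hpos.le] at hmvt
  have hprod : Real.exp (-x) * Real.exp x = 1 := by
    rw [← Real.exp_add, neg_add_cancel, Real.exp_zero]
  rw [norm_mul, Complex.norm_real, Real.norm_of_nonneg (Real.exp_pos _).le]
  calc Real.exp (-x) * ‖v (Real.exp x)‖ ≤ Real.exp (-x) * (K * Real.exp x) :=
        mul_le_mul_of_nonneg_left hmvt (Real.exp_pos _).le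
    _ = K := by rw [mul_left_comm, hprod, mul_one]

/-- WEIGHTED BOUND: if `w` is continuous, then `eˣ ‖e^{−x} w(eˣ)‖ = ‖w(eˣ)‖ ≤ K` for `x ≤ 1`, with `K = sup_{[0,e]} ‖w‖`.
[folklore] -/
theorem exp_mul_norm_expConj_le {w : ℝ → ℂ} (hw : Continuous w) :
    ∃ K : ℝ, ∀ x : ℝ, x ≤ 1 → Real.exp x * ‖((Real.exp (-x) : ℝ) : ℂ) * w (Real.exp x)‖ ≤ K := by
  obtain ⟨K, hK⟩ := (isCompact_Icc : IsCompact (Icc (0 : ℝ) (Real.exp 1))).exists_bound_of_continuousOn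
    hw.continuousOn
  refine ⟨K, fun x hx => ?_⟩
  have hmem : Real.exp x ∈ Icc (0 : ℝ) (Real.exp 1) := ⟨(Real.exp_pos x).le, Real.exp_le_exp.2 hx⟩
  have hprod : Real.exp x * Real.exp (-x) = 1 := by
    rw [← Real.exp_add, add_neg_cancel, Real.exp_zero]
  rw [norm_mul, Complex.norm_real, Real.norm_of_nonneg (Real.exp_pos _).le, ← mul_assoc, hprod, one_mul]
  exact hK _ hmem

/-! ## A centre-regular pair in conjugated form along the ray `t ↦ t e₀` -/

/-- THE `w`-COMPONENT ALONG THE RAY: for a centre-regular pair `(f, g)` there is a smooth `φ : ℝ → ℂ` with `φ(0) = 0` and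
`f(x) = e^{−x} φ(eˣ)` for all real `x` — `φ(t)` is the odd part `½[(F₁(t e₀) − F₁(−t e₀))₀ + i (F₂(t e₀) − F₂(−t e₀))₀]` of the
first coordinate of the complex radial field along the ray, and `F(±eˣ e₀) = ±(f x) eˣ e₀` componentwise. [folklore] -/
theorem exists_expConj_of_isRegularPair_left {f g : ℝ → ℂ} (h : IsRegularPair f g) :
    ∃ φ : ℝ → ℂ, ContDiff ℝ ∞ φ ∧ φ 0 = 0 ∧ f = fun x => ((Real.exp (-x) : ℝ) : ℂ) * φ (Real.exp x) := by
  obtain ⟨-, -, F₁, F₂, G₁, G₂, hF₁, hF₂, -, -, hFG⟩ := h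
  have hray : ContDiff ℝ ∞ (fun t : ℝ => t • (EuclideanSpace.single 0 1 : V3)) :=
    contDiff_id.smul contDiff_const
  have hray' : ContDiff ℝ ∞ (fun t : ℝ => -(t • (EuclideanSpace.single 0 1 : V3))) := hray.neg
  refine ⟨fun t =>
      ((((F₁ (t • (EuclideanSpace.single 0 1 : V3)) - F₁ (-(t • (EuclideanSpace.single 0 1 : V3)))) 0 / 2 : ℝ)) : ℂ) +
        ((((F₂ (t • (EuclideanSpace.single 0 1 : V3)) - F₂ (-(t • (EuclideanSpace.single 0 1 : V3)))) 0 / 2 : ℝ)) : ℂ) *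
          Complex.I, ?_, ?_, ?_⟩
  · have h1 : ContDiff ℝ ∞ (fun t : ℝ =>
        (F₁ (t • (EuclideanSpace.single 0 1 : V3)) - F₁ (-(t • (EuclideanSpace.single 0 1 : V3)))) 0) :=
      contDiff_euclidean.1 ((hF₁.comp hray).sub (hF₁.comp hray')) 0
    have h2 : ContDiff ℝ ∞ (fun t : ℝ =>
        (F₂ (t • (EuclideanSpace.single 0 1 : V3)) - F₂ (-(t • (EuclideanSpace.single 0 1 : V3)))) 0) :=
      contDiff_euclidean.1 ((hF₂.comp hray).sub (hF₂.comp hray')) 0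
    exact (Complex.ofRealCLM.contDiff.comp (h1.div_const 2)).add
      ((Complex.ofRealCLM.contDiff.comp (h2.div_const 2)).mul contDiff_const)
  · simp
  · funext x
    have hpos : 0 < Real.exp x := Real.exp_pos x
    have hny : ‖Real.exp x • (EuclideanSpace.single 0 1 : V3)‖ = Real.exp x := norm_smul_unitVec hpos.le
    have hy0 : Real.exp x • (EuclideanSpace.single 0 1 : V3) ≠ 0 := norm_pos_iff.1 (by rw [hny]; exact hpos)
    obtain ⟨h1, h2, -, -⟩ := hFG _ hy0
    obtain ⟨h1', h2', -, -⟩ := hFG _ (neg_ne_zero.2 hy0)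
    rw [hny, Real.log_exp] at h1 h2
    rw [norm_neg, hny, Real.log_exp] at h1' h2'
    have hA : (F₁ (Real.exp x • (EuclideanSpace.single 0 1 : V3)) -
        F₁ (-(Real.exp x • (EuclideanSpace.single 0 1 : V3)))) 0 / 2 = (f x).re * Real.exp x := by
      rw [← h1, ← h1', smul_neg, sub_neg_eq_add, PiLp.add_apply, smul_smul, smul_unitVec_apply_zero]
      ring
    have hB : (F₂ (Real.exp x • (EuclideanSpace.single 0 1 : V3)) -
        F₂ (-(Real.exp x • (EuclideanSpace.single 0 1 : V3)))) 0 / 2 = (f x).im * Real.exp x := by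
      rw [← h2, ← h2', smul_neg, sub_neg_eq_add, PiLp.add_apply, smul_smul, smul_unitVec_apply_zero]
      ring
    simp only [hA, hB]
    have hprod : Real.exp (-x) * Real.exp x = 1 := by
      rw [← Real.exp_add, neg_add_cancel, Real.exp_zero]
    calc f x = ((Real.exp (-x) * Real.exp x : ℝ) : ℂ) * (((f x).re : ℂ) + ((f x).im : ℂ) * Complex.I) := by
          rw [hprod, Complex.ofReal_one, one_mul]; exact (Complex.re_add_im (f x)).symm
      _ = _ := by push_cast; ring

/-- THE `s`-COMPONENT ALONG THE RAY: for a centre-regular pair `(f, g)` there is a smooth `ψ : ℝ → ℂ` with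
`g(x) = e^{−x} ψ(eˣ)` for all real `x` — `ψ(t) = G₁(t e₀) + i G₂(t e₀)`, and `G(eˣ e₀) = eˣ g(x)` componentwise. [folklore] -/
theorem exists_expConj_of_isRegularPair_right {f g : ℝ → ℂ} (h : IsRegularPair f g) :
    ∃ ψ : ℝ → ℂ, ContDiff ℝ ∞ ψ ∧ g = fun x => ((Real.exp (-x) : ℝ) : ℂ) * ψ (Real.exp x) := by
  obtain ⟨-, -, F₁, F₂, G₁, G₂, -, -, hG₁, hG₂, hFG⟩ := h
  have hray : ContDiff ℝ ∞ (fun t : ℝ => t • (EuclideanSpace.single 0 1 : V3)) :=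
    contDiff_id.smul contDiff_const
  refine ⟨fun t => ((G₁ (t • (EuclideanSpace.single 0 1 : V3)) : ℝ) : ℂ) +
      ((G₂ (t • (EuclideanSpace.single 0 1 : V3)) : ℝ) : ℂ) * Complex.I, ?_, ?_⟩
  · exact (Complex.ofRealCLM.contDiff.comp (hG₁.comp hray)).add
      ((Complex.ofRealCLM.contDiff.comp (hG₂.comp hray)).mul contDiff_const)
  · funext x
    have hpos : 0 < Real.exp x := Real.exp_pos x
    have hny : ‖Real.exp x • (EuclideanSpace.single 0 1 : V3)‖ = Real.exp x := norm_smul_unitVec hpos.le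
    have hy0 : Real.exp x • (EuclideanSpace.single 0 1 : V3) ≠ 0 := norm_pos_iff.1 (by rw [hny]; exact hpos)
    obtain ⟨-, -, h3, h4⟩ := hFG _ hy0
    rw [hny, Real.log_exp] at h3 h4
    simp only [← h3, ← h4]
    have hprod : Real.exp (-x) * Real.exp x = 1 := by
      rw [← Real.exp_add, neg_add_cancel, Real.exp_zero]
    calc g x = ((Real.exp (-x) * Real.exp x : ℝ) : ℂ) * (((g x).re : ℂ) + ((g x).im : ℂ) * Complex.I) := by
          rw [hprod, Complex.ofReal_one, one_mul]; exact (Complex.re_add_im (g x)).symm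
      _ = _ := by push_cast; ring

/-! ## The weighted `C^k` seminorms -/

/-- ONE ORDER AT A TIME: for a centre-regular pair and every `j`, `‖f⁽ʲ⁾(y)‖ + eʸ ‖g⁽ʲ⁾(y)‖` is bounded on `y ≤ 1`
(conjugated forms along the ray, `iteratedDeriv_expConj`, the unweighted bound for `f` via `φ(0) = 0`, the weighted one
for `g`). [folklore] -/
theorem iteratedDeriv_bound_of_isRegularPair_single {f g : ℝ → ℂ} (h : IsRegularPair f g) (j : ℕ) :
    ∃ K : ℝ, ∀ y : ℝ, y ≤ 1 → ‖iteratedDeriv j f y‖ + Real.exp y * ‖iteratedDeriv j g y‖ ≤ K := by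
  obtain ⟨φ, hφ, hφ0, hf⟩ := exists_expConj_of_isRegularPair_left h
  obtain ⟨ψ, hψ, hg⟩ := exists_expConj_of_isRegularPair_right h
  obtain ⟨v, hv, hv0, hvj⟩ := iteratedDeriv_expConj j hφ
  obtain ⟨w, hw, -, hwj⟩ := iteratedDeriv_expConj j hψ
  obtain ⟨K₁, hK₁⟩ := norm_expConj_le_of_apply_zero hv (hv0 hφ0)
  obtain ⟨K₂, hK₂⟩ := exp_mul_norm_expConj_le hw.continuous
  refine ⟨K₁ + K₂, fun y hy => ?_⟩
  rw [hf, hg, hvj, hwj]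
  exact add_le_add (hK₁ y hy) (hK₂ y hy)

/-- **Registered helper `iteratedDeriv_bound_of_isRegularPair` (line `sonic-cavity-renewal` v6, for stub
`stub_largeRealResolventCk`): EVERY WEIGHTED `C^k` SEMINORM OF A CENTRE-REGULAR PAIR IS FINITE ON `x ≤ 1`.** For every `k`
and every smooth centre-regular complex pair `(f, g)` there is `N` with `‖f⁽ʲ⁾(y)‖ + eʸ ‖g⁽ʲ⁾(y)‖ ≤ N` for all `y ≤ 1`,
`j ≤ k` — literally `∃ N, WCkBound k f g N` of `…SonicCavityDefsB` with the definition unfolded (a `max` over the orders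
`j ≤ k` of `iteratedDeriv_bound_of_isRegularPair_single`). [folklore] -/
theorem iteratedDeriv_bound_of_isRegularPair :
    ∀ (k : ℕ) (f g : ℝ → ℂ), IsRegularPair f g → ∃ N : ℝ, ∀ y : ℝ, y ≤ 1 → ∀ j : ℕ, j ≤ k → ‖iteratedDeriv j f y‖ + Real.exp y * ‖iteratedDeriv j g y‖ ≤ N := by
  intro k f g h
  induction k with
  | zero =>
    obtain ⟨K, hK⟩ := iteratedDeriv_bound_of_isRegularPair_single h 0
    refine ⟨K, fun y hy j hj => ?_⟩
    obtain rfl := Nat.le_zero.1 hj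
    exact hK y hy
  | succ k ih =>
    obtain ⟨N, hN⟩ := ih
    obtain ⟨K, hK⟩ := iteratedDeriv_bound_of_isRegularPair_single h (k + 1)
    refine ⟨max N K, fun y hy j hj => ?_⟩
    by_cases hjk : j ≤ k
    · exact (hN y hy j hjk).trans (le_max_left _ _)
    · obtain rfl : j = k + 1 := by omega
      exact (hK y hy).trans (le_max_right _ _)

end Summit.AtomisticToContinuum.HydrodynamicLimit.Theorems.PackingAnalyticImplosion

end
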